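import Literature.Analysis.FluidPDE.NSEssEndpointLocalHolder
import Literature.Analysis.FluidPDE.ESSLocalHolderNoConcentration
import HarnessLib

/-!
# ESS (1.14) and the endpoint criterion ns.S08, reduced to the higher regularity of bounded
# solutions alone

Analysis/FluidPDE proof file (theorems only: no definition, no named fact, no statement changed)
on the discharge path of the named facts
`Literature.Analysis.FluidPDE.ess_L5_integrability` (`NSLerayHopfProofs.lean`;
Escauriaza–Seregin–Šverák 2003, Thm. 1.3, conclusion (1.14): a Leray–Hopf weak solution of the
unforced Cauchy problem on `ℝ³ × [0, T)` lying in `L_{3,∞}(Q_T)` lies in `L₅(Q_T)`) and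
**ns.S08** `Literature.Analysis.FluidPDE.ess_endpoint` (`NSLerayHopf.lean`; ibid., Thm. 1.3 with
the uniqueness clause).

The tree proves both facts from ESS Thm. 1.4 (`ess_local_holder`) alone
(`ess_L5_integrability_of_local_holder`, `ess_endpoint_of_local_holder`,
`NSEssEndpointLocalHolder.lean`: Kato's `L³` theory, the ε-regularity criterion, the associated
pressure, the energy equality and Ladyzhenskaya–Prodi–Serrin regularity being theorems), and it
proves Thm. 1.4 from the single named fact `NSBoundedHigherRegularityBounds`
(`ess_local_holder_of_higherRegularityBounds`,
`ESSLocalHolderNoConcentration.lean`: the blow-up / backward-uniqueness / unique-continuation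
argument of ESS §3 with the CKN theorem, the class-`C¹₂` Carleman theory and the harmonic
Liouville theorem, all proved; the quantitative higher interior regularity of essentially bounded
distributional solutions — Serrin 1962, ESS §3 (3.26)–(3.30), Seregin–Šverák 2009 §2 p. 8 — being
the regularity input for the vorticity of the blow-up limit in the far field and on the strips
around regular times). This file composes the two halves, as the sibling
`NSCriticalClosureOfHigherRegularity.lean` does for ESS (3.6)
(`ess_sup_bound_of_higherRegularityBounds`) and for the `L³` continuation criterion:

* `ess_L5_integrability_of_higherRegularityBounds :
    NSBoundedHigherRegularityBounds → ess_L5_integrability`;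
* `ess_endpoint_of_higherRegularityBounds : NSBoundedHigherRegularityBounds → ess_endpoint`.

Hence **the single open leaf under ESS (1.14) and ns.S08 is `NSBoundedHigherRegularityBounds`**
(`NSBoundedHigherRegularityQuant.lean`); the discharges `ess_L5_integrability_holds` and
`ess_endpoint_holds` are the one-line applications of these theorems to
`NSBoundedHigherRegularityBounds_holds` once it lands. The kernel certifies the compositions
(`#print axioms`: `propext`, `Classical.choice`, `Quot.sound`). Nothing accepted is restated or
changed; no `sorry`; no new named fact (D-0026).

## References

* L. Escauriaza, G. Seregin, V. Šverák, *`L_{3,∞}`-solutions of Navier–Stokes equations and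
  backward uniqueness*, Uspekhi Mat. Nauk 58:2 (2003) 3–44 = Russ. Math. Surveys 58:2 (2003)
  211–250: Thm. 1.3 ((1.13) ⇒ (1.14)) and its proof in §3 ((3.1)–(3.7), (3.26)–(3.35)),
  Thm. 1.4. [EscauriazaSereginSverak2003]
* G. Seregin, V. Šverák, Comm. PDE 34 (2009) 171–201 = arXiv:0804.1803, §2 p. 8 (higher
  regularity of bounded solutions with the dependence of the norms). [SereginSverak2009]
* G. Seregin, *Lecture notes on regularity theory for the Navier–Stokes equations*, World
  Scientific (2014), §6.6 (Prop. 6.20, Thm. 6.21). [Seregin2014]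
-/

noncomputable section

namespace Literature.Analysis.FluidPDE

/-- **ESS (1.14) from the higher regularity of bounded solutions alone**
(Escauriaza–Seregin–Šverák 2003, Thm. 1.3, conclusion (1.14), proved in §3 from Thm. 1.4). The
`L₅(Q_T)` integrability of `L_{3,∞}` Leray–Hopf solutions of the Cauchy problem
(`ess_L5_integrability`) follows from the quantitative higher interior regularity of essentially
bounded distributional solutions (`NSBoundedHigherRegularityBounds`): the accepted
`ess_L5_integrability_of_local_holder` fed with ESS Thm. 1.4 in the form
`ess_local_holder_of_higherRegularityBounds`. Real proof (composition of accepted theorems); the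
discharge `ess_L5_integrability_holds` is this theorem applied to
`NSBoundedHigherRegularityBounds_holds`. [cite: EscauriazaSereginSverak2003, Thm. 1.3 (1.14), §3] -/
theorem ess_L5_integrability_of_higherRegularityBounds (hB : NSBoundedHigherRegularityBounds) :
    ess_L5_integrability :=
  ess_L5_integrability_of_local_holder (ess_local_holder_of_higherRegularityBounds hB)

/-- **The endpoint criterion ns.S08 from the higher regularity of bounded solutions alone**
(Escauriaza–Seregin–Šverák 2003, Thm. 1.3 with uniqueness: "(1.14) and hence it is smooth and
unique in `Q_T`"). `ess_endpoint` follows from `NSBoundedHigherRegularityBounds`: the accepted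
`ess_endpoint_of_local_holder` (Kato's `L³` theory, ε-regularity, the associated pressure, the
energy equality and Ladyzhenskaya–Prodi–Serrin regularity being theorems) fed with
`ess_local_holder_of_higherRegularityBounds`. Real proof; `ess_endpoint_holds` is this theorem
applied to `NSBoundedHigherRegularityBounds_holds`. [cite: EscauriazaSereginSverak2003, Thm. 1.3, §3] -/
theorem ess_endpoint_of_higherRegularityBounds (hB : NSBoundedHigherRegularityBounds) :
    ess_endpoint :=
  ess_endpoint_of_local_holder (ess_local_holder_of_higherRegularityBounds hB)

end Literature.Analysis.FluidPDE

end
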